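import Summits.Ventures.PercRepro.RankLevelSetBiIndepContainSkew
import Summits.Ventures.PercRepro.RankLevelSetIndepCDSplit

/-! # RankLevelSetMinorPairProfile — THE MIXED PROFILE OF A PAIR OF COMPLEMENTARY MINORS, ITS EXACT ELEMENT
RECURSION, THE CUMULATIVE SKEW `MinorPairSkew`, AND THE INDUCTIVE LEMMA (night-1 g29; dossier §41)

For a matroid `M` on `E` and DISJOINT sets `Y₁ Y₂ ⊆ E` (the «signature»; `K = Y₁ ∪ Y₂`, `m = #(E ∖ K)`) the
**mixed profile of the pair of complementary minors** `(M / Y₁ ∖ Y₂, M / Y₂ ∖ Y₁)` is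
`p_i(Y₁,Y₂) = minorPairCount M Y₁ Y₂ i = #{S ⊆ E ∖ K : #S = i, S ∪ Y₁ independent, ((E ∖ K) ∖ S) ∪ Y₂ independent}`
(`S` independent in `M / Y₁ ∖ Y₂`, its complement in `M / Y₂ ∖ Y₁`). Its slices: `(∅, ∅)` is the bi-independent
profile `D_i`; `(X, ∅)` is the contain-`X` profile `α^X_{i + #X}` of `RankLevelSetBiIndepContainMono`
(`biContainCount_eq_minorPairCount`); `(∅, X)` the avoid-`X` profile; `(x, w)` the «`x` in, `w` out» profile.

* **`minorPairCount_succ_split`** (the exact element recursion, NO cross term): for `w ∈ E ∖ K`,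
  `p_{i+1}(Y₁,Y₂) = p_i(Y₁ + w, Y₂) + p_{i+1}(Y₁, Y₂ + w)` (`S ∋ w ↦ S ∖ {w}`; `S ∌ w`), and
  `minorPairCount_zero_split : p_0(Y₁,Y₂) = p_0(Y₁, Y₂ + w)`. The children are again pairs of complementary minors:
  the class of such pairs is the closure of the quotient pairs `(M / X, M ∖ X)` under the recursion, and the
  «reversed pair» of the cell's §36.8 (c) is simply the child `(Y₁, Y₂ + w)`.
* **`MinorPairSkew M Y₁ Y₂ R`** (a `Prop`): the CUMULATIVE skew `p_i ≤ p_j` for all `i < j` with `i + j ≤ R`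
  («skewed right about `R/2`», in the form that needs no unimodality). With the natural `R = m + min(ρ, 0) − 1`
  (`ρ = r(M/Y₁∖Y₂) − r(M/Y₂∖Y₁)`) its slices are: `(∅,∅)`: `D_i ≤ D_j` for `i < j`, `i + j ≤ n − 1` (Mono, the
  Lorentzian consequence); `(X, ∅)` at `R = n − 2#X − 1`: EXACTLY (CX*) = `BiContainSkew`
  (**`biContainSkew_of_minorPairSkew`**); `ρ = 0`: the equal-rank slice (M₀) of dossier §41.3.
* **`minorPairSkew_of_split`** — THE INDUCTIVE LEMMA: `MinorPairSkew M (Y₁ + w) Y₂ (R − 2) → MinorPairSkew M Y₁ (Y₂ + w) R →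
  MinorPairSkew M Y₁ Y₂ R` (termwise from the split; the index shift of the through-`w` term costs exactly 2 in `R`).
  With the rank bookkeeping of §41.5 (next module) it shows that the cumulative skew on every pair with `ρ ≤ −1`
  follows from its equal-rank slice (M₀); in particular (CX*), hence (PC), (★★), Mono and (CD), are consequences
  of (M₀). Census (night-1 g29, own exact code): (M₀) and the `ρ < 0` statement on EVERY matroid with ≤ 8
  elements, all disjoint independent `Y₁, Y₂` with `#Y_i ≤ 3` — 0 failures on 3,468,084 comparisons at `n = 8`.
Nothing here asserts (M₀), (CX*) or Mono; every declaration has a docstring; imports: the cell's own modules and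
Mathlib only. Axioms: standard. -/

namespace PercRepro

open Set Matroid

variable {α : Type} (M : Matroid α) [M.Finite]

/-! ## The mixed profile of a pair of complementary minors -/

omit [M.Finite] in
/-- The family behind `minorPairCount M Y₁ Y₂ i`: `S ⊆ E ∖ (Y₁ ∪ Y₂)` with `#S = i`, `S ∪ Y₁` independent and
`((E ∖ (Y₁ ∪ Y₂)) ∖ S) ∪ Y₂` independent — the `i`-sets independent in `M / Y₁ ∖ Y₂` whose complement is
independent in `M / Y₂ ∖ Y₁`. -/
def minorPairSets (Y₁ Y₂ : Set α) (i : ℕ) : Set (Set α) :=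
  {S : Set α | S ⊆ M.E \ (Y₁ ∪ Y₂) ∧ S.ncard = i ∧ M.Indep (S ∪ Y₁) ∧
    M.Indep (((M.E \ (Y₁ ∪ Y₂)) \ S) ∪ Y₂)}

omit [M.Finite] in
/-- **The mixed profile** `p_i(Y₁, Y₂) = #minorPairSets M Y₁ Y₂ i`. -/
noncomputable def minorPairCount (Y₁ Y₂ : Set α) (i : ℕ) : ℕ := (minorPairSets M Y₁ Y₂ i).ncard

/-- `minorPairSets` is finite (a family of subsets of the finite ground set). -/
lemma minorPairSets_finite (Y₁ Y₂ : Set α) (i : ℕ) : (minorPairSets M Y₁ Y₂ i).Finite :=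
  M.ground_finite.finite_subsets.subset (fun _ hS => hS.1.trans Set.sdiff_subset)

omit [M.Finite] in
/-- `minorPairCount` is the size of `minorPairSets`. -/
lemma minorPairCount_eq_ncard (Y₁ Y₂ : Set α) (i : ℕ) : minorPairCount M Y₁ Y₂ i = (minorPairSets M Y₁ Y₂ i).ncard := rfl

/-! ## The contain-`X` profile is the `(X, ∅)` slice -/

/-- **The contain-`X` profile is the `(X, ∅)` slice**: for `X ⊆ E` and `#X ≤ k`,
`α^X_k = biContainCount M X k = minorPairCount M X ∅ (k − #X)` (`Z ↦ Z ∖ X`). -/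
lemma biContainCount_eq_minorPairCount {X : Set α} (hX : X ⊆ M.E) {k : ℕ} (hk : X.ncard ≤ k) :
    biContainCount M X k = minorPairCount M X ∅ (k - X.ncard) := by
  have hXfin : X.Finite := M.ground_finite.subset hX
  unfold biContainCount minorPairCount minorPairSets biIndep
  refine Set.ncard_congr (fun Z _ => Z \ X) ?_ ?_ ?_
  · rintro Z ⟨⟨hZE, hZcard, hZind, hZind'⟩, hXZ⟩
    refine ⟨?_, ?_, ?_, ?_⟩
    · intro x hx
      exact ⟨hZE hx.1, by simpa using hx.2⟩
    · rw [Set.ncard_sdiff hXZ hXfin, hZcard]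
    · rw [Set.sdiff_union_of_subset hXZ]; exact hZind
    · have h1 : (M.E \ (X ∪ ∅)) \ (Z \ X) ∪ ∅ = M.E \ Z := by
        ext x
        simp only [Set.union_empty, Set.mem_sdiff]
        constructor
        · rintro ⟨⟨hxE, hxX⟩, hx⟩
          exact ⟨hxE, fun hxZ => hx ⟨hxZ, hxX⟩⟩
        · rintro ⟨hxE, hxZ⟩
          exact ⟨⟨hxE, fun hxX => hxZ (hXZ hxX)⟩, fun h => hxZ h.1⟩
      rw [h1]; exact hZind'
  · rintro Z Z' ⟨-, hXZ⟩ ⟨-, hXZ'⟩ h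
    rw [← Set.sdiff_union_of_subset hXZ, ← Set.sdiff_union_of_subset hXZ', h]
  · rintro S ⟨hSE, hScard, hSind, hSind'⟩
    have hSX : Disjoint S X := by
      rw [Set.disjoint_left]
      intro x hxS hxX
      exact (hSE hxS).2 (by simp [hxX])
    have hSfin : S.Finite := M.ground_finite.subset (hSE.trans Set.sdiff_subset)
    refine ⟨S ∪ X, ⟨⟨?_, ?_, hSind, ?_⟩, Set.subset_union_right⟩, ?_⟩
    · exact Set.union_subset (hSE.trans Set.sdiff_subset) hX
    · rw [Set.ncard_union_eq hSX hSfin hXfin, hScard]; omega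
    · have h1 : M.E \ (S ∪ X) = (M.E \ (X ∪ ∅)) \ S ∪ ∅ := by
        ext x
        simp only [Set.union_empty, Set.mem_sdiff, Set.mem_union, not_or]
        tauto
      rw [h1]; exact hSind'
    · exact Set.union_sdiff_cancel_right (fun x hx => (Set.disjoint_left.mp hSX hx.1 hx.2).elim)

/-- A contain-`X` count at a level below `#X` is `0`. -/
lemma biContainCount_eq_zero_of_lt_ncard {X : Set α} {k : ℕ} (hk : k < X.ncard) :
    biContainCount M X k = 0 := by
  unfold biContainCount
  rw [Set.ncard_eq_zero ((biIndep_finite M k).subset (fun _ h => h.1))]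
  ext Z
  simp only [Set.mem_setOf_eq, Set.mem_empty_iff_false, iff_false, not_and]
  rintro ⟨hZE, hZcard, -, -⟩ hXZ
  have := Set.ncard_le_ncard hXZ (M.ground_finite.subset hZE)
  omega

/-! ## The exact element recursion -/

/-- The members of `minorPairSets M Y₁ Y₂ (i+1)` containing `w ∈ E ∖ (Y₁ ∪ Y₂)` are the members of
`minorPairSets M (insert w Y₁) Y₂ i` (`S ↦ S ∖ {w}`). -/
lemma ncard_minorPairSets_mem {Y₁ Y₂ : Set α} {w : α} (hw : w ∈ M.E \ (Y₁ ∪ Y₂)) (i : ℕ) :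
    {S ∈ minorPairSets M Y₁ Y₂ (i + 1) | w ∈ S}.ncard = minorPairCount M (insert w Y₁) Y₂ i := by
  obtain ⟨hwE, hwY⟩ := hw
  simp only [Set.mem_union, not_or] at hwY
  obtain ⟨hwY₁, hwY₂⟩ := hwY
  unfold minorPairCount minorPairSets
  refine Set.ncard_congr (fun S _ => S \ {w}) ?_ ?_ ?_
  · rintro S ⟨⟨hSE, hScard, hSind, hSind'⟩, hwS⟩
    refine ⟨?_, ?_, ?_, ?_⟩
    · intro x hx
      have hxE := hSE hx.1
      simp only [Set.mem_sdiff, Set.mem_union, Set.mem_insert_iff, Set.mem_singleton_iff, not_or] at hxE hx ⊢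
      tauto
    · rw [Set.ncard_sdiff_singleton_of_mem hwS, hScard]
      rfl
    · have h1 : S \ {w} ∪ insert w Y₁ = S ∪ Y₁ := by
        ext x
        rcases eq_or_ne x w with rfl | hxw
        · simp [hwS]
        · simp only [Set.mem_union, Set.mem_sdiff, Set.mem_singleton_iff, Set.mem_insert_iff, hxw]
          tauto
      rw [h1]; exact hSind
    · have h1 : (M.E \ (insert w Y₁ ∪ Y₂)) \ (S \ {w}) ∪ Y₂ = (M.E \ (Y₁ ∪ Y₂)) \ S ∪ Y₂ := by
        ext x
        rcases eq_or_ne x w with rfl | hxw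
        · simp [hwS, hwY₂]
        · simp only [Set.mem_union, Set.mem_sdiff, Set.mem_singleton_iff, Set.mem_insert_iff, not_or, hxw]
          tauto
      rw [h1]; exact hSind'
  · rintro S S' ⟨-, hwS⟩ ⟨-, hwS'⟩ h
    rw [← Set.insert_sdiff_self_of_mem hwS, ← Set.insert_sdiff_self_of_mem hwS', h]
  · rintro S' ⟨hS'E, hS'card, hS'ind, hS'ind'⟩
    have hwS' : w ∉ S' := fun h => (hS'E h).2 (by simp)
    have hS'fin : S'.Finite := M.ground_finite.subset (hS'E.trans Set.sdiff_subset)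
    refine ⟨insert w S', ⟨⟨?_, ?_, ?_, ?_⟩, Set.mem_insert w S'⟩, Set.insert_sdiff_self_of_notMem hwS'⟩
    · intro x hx
      rcases Set.mem_insert_iff.mp hx with rfl | hx
      · exact ⟨hwE, fun h => h.elim hwY₁ hwY₂⟩
      · have hxE := hS'E hx
        simp only [Set.mem_sdiff, Set.mem_union, Set.mem_insert_iff, not_or] at hxE ⊢
        tauto
    · rw [Set.ncard_insert_of_notMem hwS' hS'fin, hS'card]
    · have h1 : insert w S' ∪ Y₁ = S' ∪ insert w Y₁ := by
        ext x
        simp only [Set.mem_union, Set.mem_insert_iff]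
        tauto
      rw [h1]; exact hS'ind
    · have h1 : (M.E \ (Y₁ ∪ Y₂)) \ insert w S' ∪ Y₂ = (M.E \ (insert w Y₁ ∪ Y₂)) \ S' ∪ Y₂ := by
        ext x
        rcases eq_or_ne x w with rfl | hxw
        · simp [hwY₂]
        · simp only [Set.mem_union, Set.mem_sdiff, Set.mem_insert_iff, not_or, hxw]
          tauto
      rw [h1]; exact hS'ind'

omit [M.Finite] in
/-- The members of `minorPairSets M Y₁ Y₂ i` avoiding `w ∈ E ∖ (Y₁ ∪ Y₂)` ARE the members of
`minorPairSets M Y₁ (insert w Y₂) i`. -/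
lemma ncard_minorPairSets_notMem {Y₁ Y₂ : Set α} {w : α} (hw : w ∈ M.E \ (Y₁ ∪ Y₂)) (i : ℕ) :
    {S ∈ minorPairSets M Y₁ Y₂ i | w ∉ S}.ncard = minorPairCount M Y₁ (insert w Y₂) i := by
  obtain ⟨hwE, hwY⟩ := hw
  simp only [Set.mem_union, not_or] at hwY
  obtain ⟨hwY₁, hwY₂⟩ := hwY
  unfold minorPairCount minorPairSets
  congr 1
  ext S
  simp only [Set.mem_setOf_eq]
  have key : ∀ S : Set α, w ∉ S →
      (M.E \ (Y₁ ∪ insert w Y₂)) \ S ∪ insert w Y₂ = (M.E \ (Y₁ ∪ Y₂)) \ S ∪ Y₂ := by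
    intro S hwS
    ext x
    rcases eq_or_ne x w with rfl | hxw
    · simp [hwS, hwE, hwY₁, hwY₂]
    · simp only [Set.mem_union, Set.mem_sdiff, Set.mem_insert_iff, not_or, hxw]
      tauto
  constructor
  · rintro ⟨⟨hSE, hScard, hSind, hSind'⟩, hwS⟩
    refine ⟨?_, hScard, hSind, ?_⟩
    · intro x hx
      have hxE := hSE hx
      have hxw : x ≠ w := fun h => hwS (h ▸ hx)
      simp only [Set.mem_sdiff, Set.mem_union, Set.mem_insert_iff, not_or] at hxE ⊢
      tauto
    · rw [key S hwS]; exact hSind'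
  · rintro ⟨hSE, hScard, hSind, hSind'⟩
    have hwS : w ∉ S := fun h => (hSE h).2 (Or.inr (Set.mem_insert w Y₂))
    refine ⟨⟨?_, hScard, hSind, ?_⟩, hwS⟩
    · intro x hx
      have hxE := hSE hx
      simp only [Set.mem_sdiff, Set.mem_union, Set.mem_insert_iff, not_or] at hxE ⊢
      tauto
    · rw [← key S hwS]; exact hSind'

/-- **THE EXACT ELEMENT RECURSION** (no cross term): for `w ∈ E ∖ (Y₁ ∪ Y₂)`,
`p_{i+1}(Y₁, Y₂) = p_i(Y₁ + w, Y₂) + p_{i+1}(Y₁, Y₂ + w)`. -/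
theorem minorPairCount_succ_split {Y₁ Y₂ : Set α} {w : α} (hw : w ∈ M.E \ (Y₁ ∪ Y₂)) (i : ℕ) :
    minorPairCount M Y₁ Y₂ (i + 1) = minorPairCount M (insert w Y₁) Y₂ i + minorPairCount M Y₁ (insert w Y₂) (i + 1) := by
  rw [minorPairCount_eq_ncard, ncard_split_mem_elem _ (minorPairSets_finite M Y₁ Y₂ (i + 1)) w,
    ncard_minorPairSets_mem M hw i, ncard_minorPairSets_notMem M hw (i + 1)]

/-- **The recursion at level `0`**: `p_0(Y₁, Y₂) = p_0(Y₁, Y₂ + w)` (no `0`-set contains `w`). -/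
theorem minorPairCount_zero_split {Y₁ Y₂ : Set α} {w : α} (hw : w ∈ M.E \ (Y₁ ∪ Y₂)) :
    minorPairCount M Y₁ Y₂ 0 = minorPairCount M Y₁ (insert w Y₂) 0 := by
  rw [minorPairCount_eq_ncard, ncard_split_mem_elem _ (minorPairSets_finite M Y₁ Y₂ 0) w,
    ncard_minorPairSets_notMem M hw 0]
  have h0 : {S ∈ minorPairSets M Y₁ Y₂ 0 | w ∈ S} = ∅ := by
    ext S
    simp only [Set.mem_setOf_eq, Set.mem_empty_iff_false, iff_false, not_and]
    rintro ⟨hSE, hScard, -, -⟩ hwS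
    have hSfin : S.Finite := M.ground_finite.subset (hSE.trans Set.sdiff_subset)
    rw [(Set.ncard_eq_zero hSfin).mp hScard] at hwS
    exact hwS
  rw [h0, Set.ncard_empty, zero_add]

/-- The through-`w` part is at most the whole: `p_i(Y₁ + w, Y₂) ≤ p_{i+1}(Y₁, Y₂)`. -/
lemma minorPairCount_insert_left_le {Y₁ Y₂ : Set α} {w : α} (hw : w ∈ M.E \ (Y₁ ∪ Y₂)) (i : ℕ) :
    minorPairCount M (insert w Y₁) Y₂ i ≤ minorPairCount M Y₁ Y₂ (i + 1) := by
  rw [minorPairCount_succ_split M hw i]; exact Nat.le_add_right _ _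

/-- The avoid-`w` part is at most the whole: `p_i(Y₁, Y₂ + w) ≤ p_i(Y₁, Y₂)`. -/
lemma minorPairCount_insert_right_le {Y₁ Y₂ : Set α} {w : α} (hw : w ∈ M.E \ (Y₁ ∪ Y₂)) (i : ℕ) :
    minorPairCount M Y₁ (insert w Y₂) i ≤ minorPairCount M Y₁ Y₂ i := by
  cases i with
  | zero => rw [minorPairCount_zero_split M hw]
  | succ i => rw [minorPairCount_succ_split M hw i]; exact Nat.le_add_left _ _

/-! ## The cumulative skew and the inductive lemma -/

omit [M.Finite] in
/-- **The cumulative skew** (a `Prop`): `p_i(Y₁,Y₂) ≤ p_j(Y₁,Y₂)` for all `i < j` with `i + j ≤ R` — «the mixed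
profile is skewed right about `R/2`», stated without any unimodality. -/
def MinorPairSkew (Y₁ Y₂ : Set α) (R : ℕ) : Prop :=
  ∀ i j : ℕ, i < j → i + j ≤ R → minorPairCount M Y₁ Y₂ i ≤ minorPairCount M Y₁ Y₂ j

omit [M.Finite] in
/-- The cumulative skew is monotone in `R`. -/
lemma minorPairSkew_mono {Y₁ Y₂ : Set α} {R R' : ℕ} (h : MinorPairSkew M Y₁ Y₂ R) (hR : R' ≤ R) :
    MinorPairSkew M Y₁ Y₂ R' :=
  fun i j hij hR' => h i j hij (hR'.trans hR)

/-- **THE INDUCTIVE LEMMA** (dossier §41.5): if the through-`w` child `(Y₁ + w, Y₂)` is skewed with `R − 2` (the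
index shift costs exactly 2) and the avoid-`w` child `(Y₁, Y₂ + w)` is skewed with `R`, then the parent is skewed
with `R`. Purely from the exact recursion `minorPairCount_succ_split`. -/
theorem minorPairSkew_of_split {Y₁ Y₂ : Set α} {w : α} (hw : w ∈ M.E \ (Y₁ ∪ Y₂)) {R : ℕ}
    (h1 : MinorPairSkew M (insert w Y₁) Y₂ (R - 2)) (h2 : MinorPairSkew M Y₁ (insert w Y₂) R) :
    MinorPairSkew M Y₁ Y₂ R := by
  intro i j hij hR
  obtain ⟨j', rfl⟩ : ∃ j', j = j' + 1 := ⟨j - 1, by omega⟩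
  cases i with
  | zero =>
    rw [minorPairCount_zero_split M hw, minorPairCount_succ_split M hw j']
    exact (h2 0 (j' + 1) hij hR).trans (Nat.le_add_left _ _)
  | succ i' =>
    rw [minorPairCount_succ_split M hw i', minorPairCount_succ_split M hw j']
    exact Nat.add_le_add (h1 i' j' (by omega) (by omega)) (h2 (i' + 1) (j' + 1) hij hR)

/-! ## (CX*) from the cumulative skew of the `(X, ∅)` slices -/

/-- **(CX*) FROM THE CUMULATIVE SKEW OF THE `(X, ∅)` SLICES**: if for every `X ⊆ E` the contain-`X` slice
`(X, ∅)` is skewed with `R = #E − 2#X − 1`, then `BiContainSkew M`. -/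
theorem biContainSkew_of_minorPairSkew
    (h : ∀ X ⊆ M.E, MinorPairSkew M X ∅ (M.E.ncard - 2 * X.ncard - 1)) : BiContainSkew M := by
  intro X hX k hk
  rcases Nat.lt_or_ge k X.ncard with hkX | hkX
  · rw [biContainCount_eq_zero_of_lt_ncard M hkX]; exact Nat.zero_le _
  have hk' : X.ncard ≤ M.E.ncard - 1 - k := by omega
  rw [biContainCount_eq_minorPairCount M hX hkX, biContainCount_eq_minorPairCount M hX hk']
  exact h X hX _ _ (by omega) (by omega)

end PercRepro
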